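import Summits.AtomisticToContinuum.HydrodynamicLimit.Theorems.RelayRaceLocalityNearConstantShortTimeHLPackQuarticDefs
import HarnessLib

/-!
# Crux `NearConstantShortTimeHL` (stmt-AtomisticToContinuum-12502), line `small-tilt-domination` — SUPER-EXPONENTIAL INSTEAD OF GAUSSIAN
# VELOCITY TAILS along the true law: the re-typed true-law input S4‴ `TrueLawCapsPE` and the dynamic theorem `DynamicTheoremPE`
# (typed statements, lead c9, skeleton v23)

Reviewed Defs file of the line (lead prover-line-stmt-AtomisticToContinuum-12502-c9-0). WHY: after v20/v21 (`…PackQuarticDefs`, `…EndgamePQ`: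
`nearConstantShortTimeHL_of_dynamicsPQ : MomentumClosureTightnessPQ → EnergyClosureTightnessPQ → TrueLawCapsPG → crux`) the inputs along the TRUE
law are the two conjuncts of `TrueLawCapsPG`: (b) the ball-packing cap and (c′) GAUSSIAN velocity tails in mean at fixed times,
`E_{P_N}[n⁻¹ Σᵢ exp(a‖vᵢ(s)‖²)] ≤ A` for SOME `a > 0` — the Nachtergaele–Yau high-momentum Assumption II.1 transcribed. Reading the landed
Grönwall assembly (`stub_dynamicPQ`, `…DynamicPQ`; `moment_package`, `…MomentPackage`; `intFourthMoment_markov`, `…IntCapMarkov`), (c′) is consumed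
in exactly three places: (i) cubic velocity moments in mean, uniformly on `[0,t]` (`hcubic`); (ii) the cubic TAIL in mean above a level `L`,
`E[cubicTail L] ≤ L³e^{-aL²}A` (`htail`), at ONE level `L` chosen by `dyn_exists_level` so that `(tail at L) · exp(C_gi γ⁻¹ t (1+L)) ≤ κ/8` — the
truncated currents cost a factor `1+L` in the Grönwall rate, so the tail must beat `e^{C L}` for ONE constant `C = C_gi t/γ` fixed before `L`;
(iii) the integrated quartic cap along the true law by Tonelli + Markov (`x⁴ ≤ (2/a²)e^{ax²}`). All three are served by SUPER-EXPONENTIAL tails in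
mean — `E_{P_N}[n⁻¹ Σᵢ exp(b‖vᵢ(s)‖)] ≤ A_b` for EVERY `b > 0` (eventually in `N`, uniformly in `s ≤ t`): (i) `x³ ≤ (6/b³)e^{bx}`; (ii) `x³𝟙{x>L} ≤
(6/b³)e^{-bL}e^{2bx}`, and `e^{-bL}` beats `e^{CL}` once `b > C` — `b` is chosen AFTER `C`, which the `∀ b` form allows; (iii) `x⁴ ≤ (4/(e b))⁴·4!…`,
any fixed `b`. This is precisely the "minimal usable form" recorded by the barrier audit `Literature.Barriers.AtomisticToContinuum.HighMomentumCutoffNarrow`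
(block text: "the usable forms are a Gaussian-moment bound of NY type … or, minimally, super-exponential tails `sup_{N,t≤T} E_{f_t}[(N+1)⁻¹∑ e^{a|v_i|}]
< ∞` for every `a`"; scope caveat (c): "the claim that super-exponential (rather than Gaussian) tails would suffice classically is an inference from
the `e^{δ⁻¹MT₀}` structure of [NachtergaeleYau2003, §7.2], not a printed theorem"). Skeleton v23 makes that inference a kernel-checked fact for this
architecture: the true-law input becomes `TrueLawCapsPE` = (b) ∧ (c″) super-exponential velocity tails in mean, STRICTLY WEAKER than `TrueLawCapsPG`
(`trueLawCapsPE_of_PG` below: `e^{b x} ≤ e^{b²/(4a)} e^{a x²}`; the converse fails, e.g. for tails `≍ e^{-|v|^{3/2}}`), and the dynamic theorem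
`DynamicTheoremPE` = `DynamicTheoremPQ` with the Gaussian hypothesis `(a, A, hgauss)` replaced by the family of exponential moments `hexpm` (the
integrated-cap failure bound `hcapI` stays a hypothesis; level 0 produces it from `hexpm` by Markov). Target of the pass (files `…MomentPackageE`,
`…DynamicPE`, `…IntCapMarkovE`, `…ReductionPE`, `…EndgamePE`): `nearConstantShortTimeHL_of_dynamicsPE : MomentumClosureTightnessPQ →
EnergyClosureTightnessPQ → TrueLawCapsPE → NearConstantShortTimeHL`.

Contents (statements only, no mathematics): `TrueLawCapsPE` (S4‴), `DynamicTheoremPE`. PROVED (sanity of the re-typing): `trueLawCapsPE_of_PG`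
(the v20 true-law input implies the new one).
References: H.-T. Yau, Lett. Math. Phys. 22 (1991) §2; B. Nachtergaele – H.-T. Yau, Comm. Math. Phys. 243 (2003) §3.2, §7.2 (Assumption II.1 and the
`e^{δ⁻¹MT₀}` cut-off structure); S. Olla – S.R.S. Varadhan – H.-T. Yau, Comm. Math. Phys. 155 (1993) §1.
-/

noncomputable section

namespace Summit.AtomisticToContinuum.HydrodynamicLimit.Theorems.NearConstantShortTimeHL

open scoped BigOperators ENNReal
open MeasureTheory Set Filter Topology
open Literature.MathematicalPhysics.KineticTheory Literature.Analysis.FluidPDE Literature.Analysis.FunctionSpaces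

/-- **S4‴ — A-PRIORI CAPS ALONG THE TRUE LAW WITH SUPER-EXPONENTIAL (instead of Gaussian) VELOCITY TAILS, general families** (input of skeleton
v23): verbatim `TrueLawCapsPG` (`…PackQuarticDefs`) with conjunct (c′) — Gaussian tails in mean, `∃ a > 0 ∃ A, E[n⁻¹Σᵢ exp(a‖vᵢ(s)‖²)] ≤ A` —
REPLACED by (c″): for EVERY `b > 0` some `A`, eventually in `N`, `E_{P_N}[n⁻¹ Σᵢ exp(b‖vᵢ(s)‖)] ≤ A` for all `s ∈ [0,t]` (all exponential velocity
moments in mean, uniformly on `[0,t]`; true at `t = 0`; implied by (c′), `trueLawCapsPE_of_PG`; the "minimal usable form" of the high-momentum input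
named in `HighMomentumCutoffBarrierNarrow`, still OPEN and not evaded). Conjunct (b), the ball-packing cap at radius `n^{-1/4}` (twin of
`NoDenseInclusions`, stmt-14425), is unchanged. [cite: NachtergaeleYau2003, §3.2] [cite: Yau1991, §2] -/
@[conjecture] def TrueLawCapsPE : Prop :=
  ∀ η₁ : ℝ, 0 < η₁ → ∀ (a₀ θ₀ : T3 → ℝ) (u₀ : T3 → V3), Continuous a₀ → Continuous θ₀ → Continuous u₀ →
    (∀ x, 0 < a₀ x) → (∀ x, 0 < θ₀ x) → ∃ σ₀ : ℝ, 0 < σ₀ ∧ ∀ σ : ℝ, 0 < σ → σ < σ₀ →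
    ∀ (ε : ℕ → ℝ) (n : ℕ → ℕ), (∀ N, 0 < ε N) → Tendsto ε atTop (nhds 0) →
    Tendsto (fun N => (n N : ℝ) * ε N ^ 3) atTop (nhds (σ ^ 3)) →
    ∀ (T : ℝ) (ρ θ : ℝ → T3 → ℝ) (u : ℝ → T3 → V3), IsHardSphereEulerSolution σ T ρ u θ →
    ∀ Φ : (N : ℕ) → HardSphereFlow (Torus.geometry (Fin 3)) (ε N) (n N),
    let P : (N : ℕ) → Measure (Config (n N) (Fin 3) T3) := fun N =>
      particleLaw (Φ N) (canonicalDensity (Torus.geometry (Fin 3)) (ε N) (n N) (localGibbsProfile a₀ u₀ θ₀));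
    (∀ N, IsProbabilityMeasure (P N)) →
    (∀ χ : T3 → ℝ, Continuous χ → ∀ δ : ℝ, 0 < δ →
      Tendsto (fun N => P N {z | δ < |empiricalDensityField ((Φ N).flow 0 z) χ - ∫ x, χ x * ρ 0 x|}) atTop (nhds 0) ∧
      Tendsto (fun N => P N {z | δ < ‖empiricalMomentumField ((Φ N).flow 0 z) χ - ∫ x, (χ x * ρ 0 x) • u 0 x‖}) atTop (nhds 0) ∧
      Tendsto (fun N => P N {z | δ < |empiricalEnergyField ((Φ N).flow 0 z) χ -
        ∫ x, χ x * totalEnergyDensity (ρ 0 x) (u 0 x) (θ 0 x)|}) atTop (nhds 0)) →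
    ∀ t ∈ Set.Ico 0 T, (∀ s ∈ Set.Icc 0 t, ∀ x, ρ s x * σ ^ 3 ≤ η₁ / 2) →
      Tendsto (fun N => P N {z | ∃ r ∈ Set.Icc 0 t, ∃ x : T3,
        η₁ < empiricalDensityField ((Φ N).flow r z)
          (fun y => if Torus.euclidDist x y < (n N : ℝ) ^ (-(1 / 4 : ℝ))
            then (4 / 3 * Real.pi * ((n N : ℝ) ^ (-(1 / 4 : ℝ))) ^ 3)⁻¹ else 0) * σ ^ 3}) atTop (nhds 0) ∧
      (∀ b : ℝ, 0 < b → ∃ A : ℝ, ∀ᶠ N : ℕ in atTop, ∀ s ∈ Set.Icc 0 t,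
        ∫⁻ z, ENNReal.ofReal ((n N : ℝ)⁻¹ * ∑ i : Fin (n N), Real.exp (b * ‖((Φ N).flow s z i).2‖)) ∂(P N) ≤
          ENNReal.ofReal A)

/-- **THE DYNAMIC THEOREM AT FIXED DATA FROM SUPER-EXPONENTIAL TAILS** (level 1 of the Grönwall assembly of skeleton v23): verbatim
`DynamicTheoremPQ` (`…PackQuarticDefs`) with the Gaussian-tail hypothesis `{a A} (ha) (hA) (hgauss)` REPLACED by the family of exponential moments
in mean `hexpm : ∀ b > 0, ∃ A ≥ 0, ∀ᶠ N, ∀ s ∈ [0,t], E_{P_N}[n⁻¹ Σᵢ exp(b‖vᵢ(s)‖)] ≤ A`. Same conclusion. Proof (file `…DynamicPE`): the landed proof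
of `stub_dynamicPQ` with the cubic level `L` chosen AFTER the exponential rate `b := C_gi t/γ + 1` (tail `(6/b³)e^{-bL}A_{2b}` against the Grönwall
amplification `exp(C_gi γ⁻¹ t (1+L))`) and the cubic moments from `x³ ≤ (6/b³)e^{bx}` (`moment_packageE`). [cite: Yau1991, §2]
[cite: NachtergaeleYau2003, §7.2] -/
@[conjecture] def DynamicTheoremPE : Prop :=
    ∀ {η₀ : ℝ} {F : ℝ → ℝ} (hη₀ : 0 < η₀) (hFa : AnalyticOnNhd ℝ F (Set.Ioo (-η₀) η₀))
    (hEq : Set.EqOn hsExcessFreeEnergy F (Set.Ico 0 η₀))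
    {σ T : ℝ} (hσ : 0 < σ) {ρ θ : ℝ → T3 → ℝ} {u : ℝ → T3 → V3} (hE : IsHardSphereEulerSolution σ T ρ u θ)
    {t : ℝ} (ht : t ∈ Set.Ico 0 T) (ht1 : t < 1) (hband : ∀ s ∈ Set.Icc 0 t, ∀ x, ρ s x * σ ^ 3 < η₀)
    (hmass : ∫ x, ρ 0 x = 1)
    {ηP : ℝ} (hηP : 0 < ηP) (hηP₀ : ηP < η₀)
    {ε : ℕ → ℝ} {n : ℕ → ℕ} (hn : Tendsto n atTop atTop) (hε : ∀ N, 0 < ε N)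
    (Φ : (N : ℕ) → HardSphereFlow (Torus.geometry (Fin 3)) (ε N) (n N))
    (P : (N : ℕ) → Measure (Config (n N) (Fin 3) T3))
    (hPdef : ∀ N, P N = particleLaw (Φ N) (canonicalDensity (Torus.geometry (Fin 3)) (ε N) (n N)
    (localGibbsProfile (fun x => ρ 0 x * Real.exp (gChem σ (ρ 0 x))) (u 0) (θ 0))))
    (hP : ∀ N, IsProbabilityMeasure (P N))
    {π₀ : ℝ} {πst : ℝ → ℝ}
    (hπ₀ : Tendsto (fun N => (n N : ℝ)⁻¹ * Real.log (canonicalPartition (Torus.geometry (Fin 3)) (ε N) (n N)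
    (localGibbsProfile (fun x => ρ 0 x * Real.exp (gChem σ (ρ 0 x))) (u 0) (θ 0)))) atTop (nhds π₀))
    (hπ : TendstoUniformlyOn (fun N r => (n N : ℝ)⁻¹ * Real.log (canonicalPartition (Torus.geometry (Fin 3)) (ε N) (n N)
    (localGibbsProfile (fun x => ρ r x * Real.exp (gChem σ (ρ r x))) (u r) (θ r)))) πst atTop (Set.Icc 0 t))
    (hm₀ : Tendsto (fun N => ∫ z, logProfileObs σ ρ θ u 0 z ∂(P N)) atTop
    (nhds (∫ x, ρ 0 x * (Real.log (ρ 0 x) + gChem σ (ρ 0 x) - 3 / 2 * Real.log (2 * Real.pi * θ 0 x) - 3 / 2))))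
    (hm₀i : ∀ᶠ N : ℕ in atTop, Integrable (fun z => logProfileObs σ ρ θ u 0 z) (P N))
    (hiso : ∀ r ∈ Set.Icc 0 t,
    (∫ x, ρ 0 x * (Real.log (ρ 0 x) + gChem σ (ρ 0 x) - 3 / 2 * Real.log (2 * Real.pi * θ 0 x) - 3 / 2)) - π₀ =
    (∫ x, ρ r x * (Real.log (ρ r x) + gChem σ (ρ r x) - 3 / 2 * Real.log (2 * Real.pi * θ r x) - 3 / 2)) - πst r)
    {γ : ℝ} (hγ : 0 < γ)
    (hSt2 : ∀ κ : ℝ, 0 < κ → ∀ᶠ N : ℕ in atTop, ∀ r ∈ Set.Icc 0 t,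
    ∫⁻ w, ENNReal.ofReal (Real.exp (γ * (n N : ℝ) * fluctuationE (mesoRadius (n N)) (ρ r) (θ r) (u r) w))
    ∂(particleLaw (Φ N) (canonicalDensity (Torus.geometry (Fin 3)) (ε N) (n N)
    (localGibbsProfile (fun x => ρ r x * Real.exp (gChem σ (ρ r x))) (u r) (θ r)))) ≤
    ENNReal.ofReal (Real.exp (κ * (n N : ℝ))))
    (hcapP : Tendsto (fun N => P N {z | ∃ r ∈ Set.Icc 0 t, ∃ x : T3,
    ηP < empiricalDensityField ((Φ N).flow r z) (ballKernel (mesoRadius (n N)) x) * σ ^ 3}) atTop (nhds 0))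
    {C₄ : ℝ} (hC₄ : 0 ≤ C₄)
    (hcapI : ∀ K : ℝ, 0 < K → ∀ᶠ N : ℕ in atTop, P N {z | ENNReal.ofReal K <
      ∫⁻ r in Set.Icc 0 t, ENNReal.ofReal ((n N : ℝ)⁻¹ * ∑ i : Fin (n N), ‖((Φ N).flow r z i).2‖ ^ 4)} ≤
      ENNReal.ofReal (C₄ / K))
    (hexpm : ∀ b : ℝ, 0 < b → ∃ A : ℝ, 0 ≤ A ∧ ∀ᶠ N : ℕ in atTop, ∀ s ∈ Set.Icc 0 t,
    ∫⁻ z, ENNReal.ofReal ((n N : ℝ)⁻¹ * ∑ i : Fin (n N), Real.exp (b * ‖((Φ N).flow s z i).2‖)) ∂(P N) ≤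
    ENNReal.ofReal A)
    (G : (N : ℕ) → Measure (Config (n N) (Fin 3) T3)) {aI c₀ : ℝ} (haI : aI < c₀)
    (hImp : ∀ N (S : Set (Config (n N) (Fin 3) T3)), P N S ≤ ENNReal.ofReal (Real.exp (aI * n N)) * G N S)
    {η₂ η₃ : ℝ} (hη₂ : ηP ≤ η₂) (hη₃ : ηP ≤ η₃)
    (hKmom : ∀ K : ℝ, 0 < K → ∀ (s τ : ℝ), 0 ≤ s → 0 < τ → s + τ ≤ 1 →
    ∀ ψ : ℝ → T3 → V3, Torus.IsSmoothSpaceTimeOn (Set.Icc s (s + τ)) ψ →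
    (∀ r ∈ Set.Icc s (s + τ), ∀ x, ‖ψ r x‖ ≤ 1 ∧ ‖Torus.timeDerivWithin (Set.Icc s (s + τ)) ψ r x‖ ≤ 1 ∧
    ∀ i, ‖Torus.partialDeriv i (ψ r) x‖ ≤ 1) →
    ∀ δ : ℝ, 0 < δ → ∀ᶠ N : ℕ in atTop,
    G N {z | packCapOn (Φ N) z (Set.Icc s (s + τ)) (mesoRadius (n N)) σ η₂ ∧
    intMomentCapOn (Φ N) z (Set.Icc s (s + τ)) K ∧
    δ < |momDefect σ (Φ N) z (mesoRadius (n N)) s τ ψ|} ≤ ENNReal.ofReal (Real.exp (-(c₀ * n N))))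
    (hKen : ∀ K : ℝ, 0 < K → ∀ (s τ : ℝ), 0 ≤ s → 0 < τ → s + τ ≤ 1 →
    ∀ φ : ℝ → T3 → ℝ, Torus.IsSmoothSpaceTimeOn (Set.Icc s (s + τ)) φ →
    (∀ r ∈ Set.Icc s (s + τ), ∀ x, |φ r x| ≤ 1 ∧ |Torus.timeDerivWithin (Set.Icc s (s + τ)) φ r x| ≤ 1 ∧
    ∀ i, |Torus.partialDeriv i (φ r) x| ≤ 1) →
    ∀ δ : ℝ, 0 < δ → ∀ᶠ N : ℕ in atTop,
    G N {z | packCapOn (Φ N) z (Set.Icc s (s + τ)) (mesoRadius (n N)) σ η₃ ∧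
    intMomentCapOn (Φ N) z (Set.Icc s (s + τ)) K ∧
    δ < |enDefect σ (Φ N) z (mesoRadius (n N)) s τ φ|} ≤ ENNReal.ofReal (Real.exp (-(c₀ * n N)))),
    ∀ κ : ℝ, 0 < κ → ∀ᶠ N in atTop,
    Integrable (fun z => logProfileObs σ ρ θ u t ((Φ N).flow t z)) (P N) ∧
    (∫ x, ρ t x * (Real.log (ρ t x) + gChem σ (ρ t x) - 3 / 2 * Real.log (2 * Real.pi * θ t x) - 3 / 2)) - κ ≤
    ∫ z, logProfileObs σ ρ θ u t ((Φ N).flow t z) ∂(P N)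


/-! ## The re-typed statement against the v20 one -/

/-- Pointwise: `exp (b x) ≤ exp (b² / (4a)) · exp (a x²)` for `a > 0` (AM–GM: `b x ≤ a x² + b²/(4a)`). [folklore] -/
theorem exp_mul_le_exp_mul_sq {a : ℝ} (ha : 0 < a) (b x : ℝ) :
    Real.exp (b * x) ≤ Real.exp (b ^ 2 / (4 * a)) * Real.exp (a * x ^ 2) := by
  rw [← Real.exp_add]
  apply Real.exp_le_exp.2
  have h : 0 ≤ a * (x - b / (2 * a)) ^ 2 := by positivity
  have e : a * (x - b / (2 * a)) ^ 2 = a * x ^ 2 - b * x + b ^ 2 / (4 * a) := by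
    field_simp
    ring
  linarith [h, e]

/-- **S4″ ⇒ S4‴**: Gaussian velocity tails in mean imply all exponential velocity moments in mean (the v20 true-law input implies the v23 one).
[folklore] -/
theorem trueLawCapsPE_of_PG : TrueLawCapsPG → TrueLawCapsPE := by
  intro H η₁ hη₁ a₀ θ₀ u₀ hac hθc huc ha0 hθ0
  obtain ⟨σ₀, hσ₀, H'⟩ := H η₁ hη₁ a₀ θ₀ u₀ hac hθc huc ha0 hθ0
  refine ⟨σ₀, hσ₀, fun σ hσ hσ' ε n hε hε0 hn T ρ θ u hE Φ => ?_⟩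
  have H'' := H' σ hσ hσ' ε n hε hε0 hn T ρ θ u hE Φ
  dsimp only at H'' ⊢
  intro hP h0 t ht hpack
  obtain ⟨hcap, a, ha, A, hgauss⟩ := H'' hP h0 t ht hpack
  refine ⟨hcap, fun b hb => ⟨Real.exp (b ^ 2 / (4 * a)) * max A 0, ?_⟩⟩
  filter_upwards [hgauss] with N hN s hs
  have hpt : ∀ z : Config (n N) (Fin 3) T3,
      ENNReal.ofReal ((n N : ℝ)⁻¹ * ∑ i : Fin (n N), Real.exp (b * ‖((Φ N).flow s z i).2‖)) ≤
        ENNReal.ofReal (Real.exp (b ^ 2 / (4 * a))) *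
          ENNReal.ofReal ((n N : ℝ)⁻¹ * ∑ i : Fin (n N), Real.exp (a * ‖((Φ N).flow s z i).2‖ ^ 2)) := by
    intro z
    rw [← ENNReal.ofReal_mul (Real.exp_pos _).le]
    apply ENNReal.ofReal_le_ofReal
    have hsum : ∑ i : Fin (n N), Real.exp (b * ‖((Φ N).flow s z i).2‖) ≤
        ∑ i : Fin (n N), Real.exp (b ^ 2 / (4 * a)) * Real.exp (a * ‖((Φ N).flow s z i).2‖ ^ 2) :=
      Finset.sum_le_sum fun i _ => exp_mul_le_exp_mul_sq ha b _
    rw [← Finset.mul_sum] at hsum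
    calc (n N : ℝ)⁻¹ * ∑ i, Real.exp (b * ‖((Φ N).flow s z i).2‖)
        ≤ (n N : ℝ)⁻¹ * (Real.exp (b ^ 2 / (4 * a)) * ∑ i, Real.exp (a * ‖((Φ N).flow s z i).2‖ ^ 2)) :=
          mul_le_mul_of_nonneg_left hsum (by positivity)
      _ = Real.exp (b ^ 2 / (4 * a)) * ((n N : ℝ)⁻¹ * ∑ i, Real.exp (a * ‖((Φ N).flow s z i).2‖ ^ 2)) := by ring
  calc ∫⁻ z, ENNReal.ofReal ((n N : ℝ)⁻¹ * ∑ i : Fin (n N), Real.exp (b * ‖((Φ N).flow s z i).2‖)) ∂_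
      ≤ ∫⁻ z, ENNReal.ofReal (Real.exp (b ^ 2 / (4 * a))) *
          ENNReal.ofReal ((n N : ℝ)⁻¹ * ∑ i : Fin (n N), Real.exp (a * ‖((Φ N).flow s z i).2‖ ^ 2)) ∂_ :=
        lintegral_mono fun z => hpt z
    _ = ENNReal.ofReal (Real.exp (b ^ 2 / (4 * a))) *
          ∫⁻ z, ENNReal.ofReal ((n N : ℝ)⁻¹ * ∑ i : Fin (n N), Real.exp (a * ‖((Φ N).flow s z i).2‖ ^ 2)) ∂_ :=
        lintegral_const_mul' _ _ ENNReal.ofReal_ne_top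
    _ ≤ ENNReal.ofReal (Real.exp (b ^ 2 / (4 * a))) * ENNReal.ofReal (max A 0) := by
        gcongr
        exact (hN s hs).trans (ENNReal.ofReal_le_ofReal (le_max_left _ _))
    _ = ENNReal.ofReal (Real.exp (b ^ 2 / (4 * a)) * max A 0) := (ENNReal.ofReal_mul (Real.exp_pos _).le).symm

end Summit.AtomisticToContinuum.HydrodynamicLimit.Theorems.NearConstantShortTimeHL

end
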